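import Summits.CriticalPhenomena.PercolationContinuityZ3.Theorems.Transplant.AutChartOrbitsQCylinders
import Summits.CriticalPhenomena.PercolationContinuityZ3.Theorems.Transplant.AutEndStateDefs
import HarnessLib

/-!
# END-STATE CONTINUITY ⟺ CONTINUITY ON QUASI-STEP ORBIT DATA: the open end-state statement `BenjaminiSchramm1996_conj4_endState` (p4 gen 27) is EQUIVALENT to
# `θ_v(p_c) = 0` on every connected locally finite graph carrying an `AutChart.OrbitQDatum` — so a quasi-step frames node closes the end state BY NAME

builds on p205010 (kernel theorem, internal audit signed; external expert review pending) — nothing in this file uses p205010.  The `@[conjecture]`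
`BenjaminiSchramm1996_conj4_endState` («AutEndStateDefs», OPEN) is neither edited nor asserted: it appears as a hypothesis (§3) or as a conclusion from a hypothesis
of the same strength (§2).  Lane `prim-bschramm`, seat `prim-bschramm-p3` gen 28 (design owner; N3B-RUNG.md: the target of the quasi-step rung, pinned).  Helper file
(`--supports stmt-CriticalPhenomena-4575 --as helper`).

WHY.  The end-state class (a subgroup `A₀ ≤ Aut(G)` with finitely many orbits and a rank-two character killing every stabiliser) is where the skeleton ladder ends
(P4-GENERAL §41.5/§49; `EndStateVirtNil.conj4_cayley_of_endState`: it gives Conj. 4 for every Cayley graph of every virtually nilpotent group; with Trofimov, for every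
quasi-transitive graph of polynomial growth).  This seat's «AutChartOrbitsGoodCoordinates»/«AutChartOrbitsQDatum»/«…QCylinders» (p494591/p497322/p497462) turn the
end-state input, OFF exponential growth, into a QUASI-STEP ORBIT DATUM (`exists_orbitQDatum`); ON exponential growth Hutchcroft's theorem needs nothing.  Hence:
* §1 `AutChart.exists_transversal` — a covering set of representatives contains a TRANSVERSAL (one representative per orbit; needed because the end-state statement
  quantifies over arbitrary finite covering sets);
* §2 **`conj4_endState_of_orbitQuasi`**: if `θ_v(p_c) = 0` on every connected locally finite graph with an `OrbitQDatum` (the conclusion a quasi-step frames node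
  delivers through `OrbitQDatum.skeletonQ`-type packaging), then `BenjaminiSchramm1996_conj4_endState`;
* §3 **`orbitQuasi_of_conj4_endState`**: conversely an `OrbitQDatum` IS an end-state input (left translations `a ↦ smulIso a` as a subgroup of `Aut(G)`, the character
  factoring through it because elements acting trivially lie in every stabiliser, rank two from the quasi-steps), so end-state continuity gives `θ_v(p_c) = 0` on it;
* **`conj4_endState_iff_orbitQuasi`** — the equivalence.  So the rung N3-b has a NAMED target in the tree and loses nothing on the customer side.
[cite: BenjaminiSchramm1996, Conj. 4; §2 (almost transitive graphs)] [cite: KozmaNitzan2024, §4 p. 16 (Lemma 8)] [cite: Hutchcroft2016, Thm. 1.1]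
-/

noncomputable section

namespace Summit.CriticalPhenomena.PercolationContinuityZ3.Theorems.Transplant

open SimpleGraph Filter Literature.Barriers.CriticalPhenomena Literature.Probability.LatticeModels Literature.Probability.Percolation
open scoped Classical

namespace AutChart

variable {V : Type} {G : SimpleGraph V} {A : Type} [Group A] [MulAction A V]

/-! ## §1 A covering set of representatives contains a transversal -/

/-- **A finite covering set of representatives contains a TRANSVERSAL** (pick one representative in each orbit met). [folklore] -/
theorem exists_transversal (reps : Finset V) (hcover : ∀ w : V, ∃ a : A, ∃ r ∈ reps, a • r = w) :
    ∃ reps' : Finset V, (∀ r ∈ reps', ∀ r' ∈ reps', ∀ a : A, a • r = r' → r = r') ∧ (∀ w : V, ∃ a : A, ∃ r ∈ reps', a • r = w) := by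
  let q : V → MulAction.orbitRel.Quotient A V := Quotient.mk (MulAction.orbitRel A V)
  -- a representative in `reps` for every orbit met by `reps`
  have hsec : ∀ o : MulAction.orbitRel.Quotient A V, ∃ r : V, (∃ r₀ ∈ reps, q r₀ = o) → (r ∈ reps ∧ q r = o) := by
    intro o
    by_cases h : ∃ r₀ ∈ reps, q r₀ = o
    · obtain ⟨r₀, hr₀, hq⟩ := h; exact ⟨r₀, fun _ => ⟨hr₀, hq⟩⟩
    · exact ⟨Classical.choice (by obtain ⟨a, r, hr, -⟩ := hcover (Classical.choice (by
          induction o using Quotient.inductionOn with | h v => exact ⟨v⟩)); exact ⟨r⟩), fun h' => absurd h' h⟩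
  choose sec hsec using hsec
  refine ⟨(reps.image q).image sec, ?_, ?_⟩
  · intro r hr r' hr' a ha
    obtain ⟨o, ho, rfl⟩ := Finset.mem_image.1 hr
    obtain ⟨o', ho', rfl⟩ := Finset.mem_image.1 hr'
    obtain ⟨r₀, hr₀, hq₀⟩ := Finset.mem_image.1 ho
    obtain ⟨r₀', hr₀', hq₀'⟩ := Finset.mem_image.1 ho'
    have h1 := (hsec o ⟨r₀, hr₀, hq₀⟩).2
    have h2 := (hsec o' ⟨r₀', hr₀', hq₀'⟩).2
    have hoo : o = o' := by
      rw [← h1, ← h2]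
      refine Quotient.sound ?_
      show (MulAction.orbitRel A V) (sec o) (sec o')
      rw [MulAction.orbitRel_apply, MulAction.mem_orbit_iff]
      exact ⟨a⁻¹, by rw [← ha, inv_smul_smul]⟩
    rw [hoo]
  · intro w
    obtain ⟨a, r₀, hr₀, rfl⟩ := hcover w
    have hmem : q r₀ ∈ reps.image q := Finset.mem_image_of_mem _ hr₀
    obtain ⟨hsr, hsq⟩ := hsec (q r₀) ⟨r₀, hr₀, rfl⟩
    have hrel : (MulAction.orbitRel A V) (sec (q r₀)) r₀ := Quotient.exact hsq
    rw [MulAction.orbitRel_apply, MulAction.mem_orbit_iff] at hrel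
    obtain ⟨b, hb⟩ := hrel
    refine ⟨a * b⁻¹, sec (q r₀), Finset.mem_image_of_mem _ hmem, ?_⟩
    rw [mul_smul, ← hb, inv_smul_smul]

/-! ## §2 Continuity on quasi-step orbit data ⟹ END-STATE CONTINUITY -/

/-- **If every connected locally finite graph carrying a quasi-step orbit datum has `θ_v(p_c) = 0`, then END-STATE CONTINUITY holds** (`BenjaminiSchramm1996_conj4_endState`,
the p4-g27 `@[conjecture]`, concluded BY NAME from a hypothesis of node shape): ON exponential growth Hutchcroft; OFF it the end-state input — shrunk to a transversal —
gives an `OrbitQDatum` by `exists_orbitQDatum` (good coordinates + relative Milnor), and the hypothesis applies.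
builds on p205010 (kernel theorem, internal audit signed; external expert review pending). [cite: BenjaminiSchramm1996, Conj. 4; §2] [cite: Hutchcroft2016, Thm. 1.1] -/
theorem conj4_endState_of_orbitQuasi
    (hQ : ∀ {W : Type} (G' : SimpleGraph W) [G'.LocallyFinite] {B : Type} [Group B] [MulAction B W], OrbitQDatum G' B →
      ∀ v : W, theta G' v (criticalProbIOf G' v) = 0) :
    BenjaminiSchramm1996_conj4_endState := by
  intro W G' _ hc A₀ reps c horb hstab hrank x
  letI : MulAction (G' ≃g G') W := autMulAction G'
  have hact : IsActionByAut G' A₀ := fun a y z => (a : G' ≃g G').map_rel_iff'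
  have hcover : ∀ w : W, ∃ a : A₀, ∃ r ∈ reps, a • r = w := fun w => by
    obtain ⟨a, s, hs, hw⟩ := horb w; exact ⟨a, s, hs, hw⟩
  by_cases hG : HasExponentialGrowth G'
  · exact Hutchcroft2016_noPercolationAtCriticality_holds G' hc (isQuasiTransitive_of_finite_orbits hact reps hcover) hG x
  · obtain ⟨reps', htrans', hcover'⟩ := exists_transversal (A := A₀) reps hcover
    have hstab' : ∀ h ∈ MulAction.stabilizer A₀ x, c h = 1 := fun h hh => hstab h x (MulAction.mem_stabilizer_iff.1 hh)
    obtain ⟨D⟩ := exists_orbitQDatum hact hc reps' htrans' hcover' c hstab' hrank hG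
    exact hQ G' D x

/-! ## §3 An `OrbitQDatum` is an end-state input ⟹ the converse -/

namespace OrbitQDatum

/-- The action map `A → Aut(G)`, `a ↦ (a • ·)`. [folklore] -/
def autHom (D : OrbitQDatum G A) : A →* (G ≃g G) where
  toFun a := smulIso D.act a
  map_one' := RelIso.ext fun w => by simp
  map_mul' a b := RelIso.ext fun w => by simp [mul_smul]

/-- `autHom a w = a • w`. [folklore] -/
@[simp] theorem autHom_apply (D : OrbitQDatum G A) (a : A) (w : V) : D.autHom a w = a • w := rfl

/-- **Elements acting alike have the same character value** (their quotient fixes every vertex; `V` non-empty). [folklore] -/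
theorem ψ_eq_of_autHom_eq (D : OrbitQDatum G A) [Nonempty V] {a b : A} (h : D.autHom a = D.autHom b) : D.ψ a = D.ψ b := by
  obtain ⟨w⟩ := ‹Nonempty V›
  have hfix : (b⁻¹ * a) • w = w := by
    have := congrArg (fun e : G ≃g G => e w) h
    simp only [autHom_apply] at this
    rw [mul_smul, this, inv_smul_smul]
  have h0 := D.ψ_stab w _ (MulAction.mem_stabilizer_iff.2 hfix)
  rw [D.ψ_mul, D.ψ_inv] at h0
  exact (neg_add_eq_zero.1 h0).symm

/-- **The character on the image subgroup `A₀ = autHom(A) ≤ Aut(G)`** (well defined by `ψ_eq_of_autHom_eq`). [folklore] -/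
def charOnRange (D : OrbitQDatum G A) [Nonempty V] : D.autHom.range →* Multiplicative (Site 2) where
  toFun α := Multiplicative.ofAdd (D.ψ (Classical.choose α.2))
  map_one' := by
    have h := Classical.choose_spec (1 : D.autHom.range).2
    rw [← ofAdd_zero, ← D.ψ_one]
    congr 1
    exact D.ψ_eq_of_autHom_eq (by rw [h, map_one]; rfl)
  map_mul' α β := by
    rw [← ofAdd_add, ← D.ψ_mul]
    congr 1
    refine D.ψ_eq_of_autHom_eq ?_
    rw [Classical.choose_spec (α * β).2, map_mul, Classical.choose_spec α.2, Classical.choose_spec β.2]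
    rfl

/-- The character on the image, evaluated at the image of `a`, is `ψ a`. [folklore] -/
theorem charOnRange_mk (D : OrbitQDatum G A) [Nonempty V] (a : A) :
    Multiplicative.toAdd (D.charOnRange ⟨D.autHom a, ⟨a, rfl⟩⟩) = D.ψ a := by
  show D.ψ (Classical.choose (⟨a, rfl⟩ : D.autHom a ∈ D.autHom.range)) = D.ψ a
  exact D.ψ_eq_of_autHom_eq (Classical.choose_spec (⟨a, rfl⟩ : D.autHom a ∈ D.autHom.range))

end OrbitQDatum

/-- **END-STATE CONTINUITY ⟹ `θ_v(p_c) = 0` on every connected locally finite graph with a quasi-step orbit datum**: the datum IS an end-state input — the subgroup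
`autHom(A) ≤ Aut(G)` has finitely many orbits (`reps`), the character factors through it and kills every stabiliser, and the quasi-steps at a representative give
two values `N e₀`, `N e₁` of rank two. [cite: BenjaminiSchramm1996, Conj. 4; §2 (almost transitive graphs)] -/
theorem orbitQuasi_of_conj4_endState (hE : BenjaminiSchramm1996_conj4_endState) {V : Type} (G : SimpleGraph V) [G.LocallyFinite] {A : Type} [Group A]
    [MulAction A V] (D : OrbitQDatum G A) (v : V) : theta G v (criticalProbIOf G v) = 0 := by
  haveI : Nonempty V := ⟨v⟩
  -- the rank-two pair from the quasi-steps at the representative of `v`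
  obtain ⟨b, r₀, hr₀, rfl⟩ := D.cover v
  obtain ⟨a₀, -, -, -, -, hψ₀, -⟩ := D.qstep r₀ hr₀ 0 1
  obtain ⟨a₁, -, -, -, -, hψ₁, -⟩ := D.qstep r₀ hr₀ 1 1
  refine hE G D.conn D.autHom.range D.reps D.charOnRange (fun w => ?_) (fun α w hαw => ?_) ⟨⟨D.autHom a₀, ⟨a₀, rfl⟩⟩, ⟨D.autHom a₁, ⟨a₁, rfl⟩⟩, ?_⟩ (b • r₀)
  · obtain ⟨a, r, hr, rfl⟩ := D.cover w
    exact ⟨⟨D.autHom a, ⟨a, rfl⟩⟩, r, hr, rfl⟩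
  · obtain ⟨α, a, rfl⟩ := α
    have hfix : a • w = w := hαw
    have h := D.charOnRange_mk a
    rw [D.ψ_stab w a (MulAction.mem_stabilizer_iff.2 hfix)] at h
    rw [← ofAdd_toAdd (D.charOnRange ⟨D.autHom a, ⟨a, rfl⟩⟩), h, ofAdd_zero]
  · rw [D.charOnRange_mk, D.charOnRange_mk, hψ₀, hψ₁, Units.val_one, mul_one, MaxArea.det2]
    have hN : D.N ≠ 0 := by have := D.one_le_N; omega
    simp [hN]

/-- **THE EQUIVALENCE**: END-STATE CONTINUITY holds iff `θ_v(p_c) = 0` on every connected locally finite graph carrying a quasi-step orbit datum — the named target of the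
quasi-step rung. [cite: BenjaminiSchramm1996, Conj. 4; §2] -/
theorem conj4_endState_iff_orbitQuasi : BenjaminiSchramm1996_conj4_endState ↔
    ∀ {W : Type} (G' : SimpleGraph W) [G'.LocallyFinite] {B : Type} [Group B] [MulAction B W], OrbitQDatum G' B →
      ∀ v : W, theta G' v (criticalProbIOf G' v) = 0 :=
  ⟨fun hE _ G' _ _ _ _ D v => orbitQuasi_of_conj4_endState hE G' D v, fun hQ => conj4_endState_of_orbitQuasi hQ⟩

end AutChart

end Summit.CriticalPhenomena.PercolationContinuityZ3.Theorems.Transplant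

end
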